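/- Copyright: ym3-torus cell, WIDTH-5 ATTACH seat `ym-ust-19936-w4` (prover, g10), for crux `HistoryTailL` (stmt-QuantumFields-19936),
level-0 prefactor-free infrastructure (T2) of LINE `local_insertion` (#13) ∕ K1.  Released under the licence of the surrounding project. -/
import Literature.MathematicalPhysics.QuantumFieldTheory.LatticeRPMechanism
import HarnessLib

/-!
# Triangular Haar integration: words with a private, later-eliminated letter are independent and Haar-distributed

Support file (`--supports stmt-QuantumFields-19936 --as helper`), step (T2a) of the level-0 PREFACTOR-FREE plan of the cell
(memo `PREFACTOR-FREE-LEVEL0-w7g9.md` §1 (c) «triangular ∕ complete-axial-gauge integration», LEAD ★w1-19936 g7 00:00:53Z): the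
abstract measure-theoretic mechanism behind the UPPER Gaussian bound on the Wilson partition function
`Z ≤ z(β)^{#links with a private plaquette}` — nothing lattice-specific here.

SETTING.  A finite product `ι → G` of copies of a group `G` carrying a bi-invariant probability measure `μ₀` (product measure
`LatticeRP.piMeasure μ₀`); a finite set `A ⊆ ι` of ELIMINATED coordinates with a rank `r : ι → ℕ` (the elimination order); for
each `i ∈ A` a WORD `V_i(U) = a_i(U) · U(i) · b_i(U)` whose outer letters `a_i, b_i` depend only on coordinates that are either
not eliminated or eliminated LATER (`j ≠ i ∧ (j ∈ A → r i < r j)`); bounded measurable weights `w_i ≥ 0`.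

WHAT.  §1 one coordinate: `integral_eval_eq` (the marginal of one coordinate is `μ₀`), `integral_mul_mul_eq` (bi-invariance
`∫ w(a g b) = ∫ w`), and the ONE-STEP IDENTITY **`integral_word_mul_eq`**: if `a, b, F` do not depend on the coordinate `c`, then
`∫ w(a(U)·U(c)·b(U))·F(U) dμ = (∫ w dμ₀)·∫ F dμ` (Fubini along the coordinate splice `LatticeRP.splice {c}` + bi-invariance).
§2 **`integral_prod_words_eq`** — THE TRIANGULAR IDENTITY: `∫ ∏_{i∈A} w_i(V_i U) dμ = ∏_{i∈A} ∫ w_i dμ₀` (induction on `A` peeling the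
coordinate of least rank, `Finset.induction_on_min_value`); **`integral_prod_words_mul_le`** — with an extra factor `0 ≤ R ≤ 1` (the
«dropped plaquettes»): `∫ (∏_{i∈A} w_i(V_i U))·R(U) dμ ≤ ∏_{i∈A} ∫ w_i dμ₀`; and **`integral_prod_words_mul_le_pow`**: if moreover
`∫ w_i dμ₀ ≤ z` for all `i ∈ A` then `≤ z^{#A}`.

HONEST SCOPE.  Folklore measure theory (Fubini + invariance of Haar measure; M. Creutz, *Quarks, gluons and lattices*, Ch. 9; S.
Chatterjee, arXiv:1602.01222 §3 «axial gauge»); no lattice, no estimate of Bałaban's papers; nothing of LINE #13's stubs, of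
`HistoryTailL` or of any crux is proved.  The lattice instance (T2b∕c: the elimination order on `(ℤ∕nℤ)³` with `2n³ − n² − n` private
plaquettes) is the sequel file.  YM₃ on T³ is rung R3 of the ladder — not d = 4, not infinite volume, not a mass gap, not Clay.
-/

namespace Summit.QuantumFields.YangMills.Theorems.LocalInsertion.TriangularHaar

open MeasureTheory Finset
open Literature.MathematicalPhysics.QuantumFieldTheory.LatticeRP (piMeasure splice splice_apply measurable_splice
  measurePreserving_splice)

noncomputable section

variable {ι : Type*} [Fintype ι] [DecidableEq ι] {G : Type*} [Group G] [MeasurableSpace G] [MeasurableMul₂ G]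
variable (μ₀ : Measure G) [IsProbabilityMeasure μ₀] [μ₀.IsMulLeftInvariant] [μ₀.IsMulRightInvariant]

/-! ## §1 One coordinate -/

omit [DecidableEq ι] [Group G] [MeasurableMul₂ G] [μ₀.IsMulLeftInvariant] [μ₀.IsMulRightInvariant] in
/-- The marginal of one coordinate of the product measure is `μ₀`: `∫ φ(Y c) dμ(Y) = ∫ φ dμ₀`. [folklore] -/
theorem integral_eval_eq (c : ι) {φ : G → ℝ} (hφ : Measurable φ) :
    ∫ Y, φ (Y c) ∂piMeasure μ₀ = ∫ g, φ g ∂μ₀ := by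
  have h := MeasureTheory.measurePreserving_eval (fun _ : ι => μ₀) c
  have e : ∫ g, φ g ∂μ₀ = ∫ g, φ g ∂(Measure.map (Function.eval c) (piMeasure (ι := ι) μ₀)) := by
    rw [h.map_eq]
  rw [e, integral_map h.measurable.aemeasurable hφ.aestronglyMeasurable]

omit [MeasurableMul₂ G] [IsProbabilityMeasure μ₀] in
/-- Bi-invariance: `∫ w(a·g·b) dμ₀(g) = ∫ w dμ₀`. [folklore] -/
theorem integral_mul_mul_eq [MeasurableMul G] (w : G → ℝ) (a b : G) :
    ∫ g, w (a * g * b) ∂μ₀ = ∫ g, w g ∂μ₀ := by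
  have h1 : (fun g => w (a * g * b)) = fun g => (fun x => w (x * b)) (a * g) := rfl
  rw [h1, integral_mul_left_eq_self (fun x => w (x * b)) a, integral_mul_right_eq_self w b]

omit [Fintype ι] [DecidableEq ι] [Group G] [MeasurableSpace G] [MeasurableMul₂ G] in
/-- Off the spliced coordinate `c`, `splice {c} (U, Y)` agrees with `U`. [folklore] -/
theorem splice_singleton_agree [DecidableEq ι] (c : ι) (U Y : ι → G) :
    ∀ j ∈ {j : ι | j ≠ c}, splice {c} (U, Y) j = U j := by
  intro j hj
  have hj' : j ≠ c := hj
  simp [splice_apply, hj']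

omit [Fintype ι] [DecidableEq ι] [Group G] [MeasurableSpace G] [MeasurableMul₂ G] in
/-- At the spliced coordinate, `splice {c} (U, Y) c = Y c`. [folklore] -/
theorem splice_singleton_self [DecidableEq ι] (c : ι) (U Y : ι → G) : splice {c} (U, Y) c = Y c := by
  simp [splice_apply]

/-- **THE ONE-STEP IDENTITY.**  If the outer letters `a, b` of the word `a(U)·U(c)·b(U)` and the co-factor `F` do not depend on the
coordinate `c`, then `∫ w(a(U)·U(c)·b(U))·F(U) dμ = (∫ w dμ₀)·(∫ F dμ)` — conditionally on the other coordinates the word is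
Haar-distributed (bi-invariance), so it is independent of them. [folklore] -/
theorem integral_word_mul_eq (c : ι) {a b : (ι → G) → G} (ha : Measurable a) (hb : Measurable b)
    (haD : DependsOn a {j : ι | j ≠ c}) (hbD : DependsOn b {j : ι | j ≠ c})
    {w : G → ℝ} (hw : Measurable w) {B : ℝ} (hwB : ∀ g, |w g| ≤ B)
    {F : (ι → G) → ℝ} (hF : Measurable F) {C : ℝ} (hFC : ∀ U, |F U| ≤ C) (hFD : DependsOn F {j : ι | j ≠ c}) :
    ∫ U, w (a U * U c * b U) * F U ∂piMeasure μ₀ = (∫ g, w g ∂μ₀) * ∫ U, F U ∂piMeasure μ₀ := by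
  set Φ : (ι → G) → ℝ := fun U => w (a U * U c * b U) * F U with hΦ_def
  have hΦm : Measurable Φ := (hw.comp ((ha.mul (measurable_pi_apply c)).mul hb)).mul hF
  have hB0 : 0 ≤ B := (abs_nonneg _).trans (hwB 1)
  have hΦb : ∀ U, |Φ U| ≤ B * C := fun U => by
    rw [hΦ_def]; dsimp only
    rw [abs_mul]
    exact mul_le_mul (hwB _) (hFC _) (abs_nonneg _) hB0
  -- change of variables along the coordinate splice
  have hsp := measurePreserving_splice μ₀ ({c} : Finset ι)
  have h1 : ∫ U, Φ U ∂piMeasure μ₀ = ∫ p, Φ (splice {c} p) ∂((piMeasure μ₀).prod (piMeasure μ₀)) := by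
    rw [← integral_map hsp.measurable.aemeasurable hΦm.aestronglyMeasurable, hsp.map_eq]
  -- the spliced integrand
  have h2 : ∀ U Y : ι → G, Φ (splice {c} (U, Y)) = F U * w (a U * Y c * b U) := by
    intro U Y
    have hag := splice_singleton_agree (G := G) c U Y
    rw [hΦ_def]; dsimp only
    rw [haD hag, hbD hag, hFD hag, splice_singleton_self, mul_comm]
  have hint : Integrable (fun p : (ι → G) × (ι → G) => Φ (splice {c} p)) ((piMeasure μ₀).prod (piMeasure μ₀)) :=
    Integrable.of_bound (hΦm.comp (measurable_splice {c})).aestronglyMeasurable (B * C)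
      (ae_of_all _ fun p => by rw [Real.norm_eq_abs]; exact hΦb _)
  rw [show (∫ U, w (a U * U c * b U) * F U ∂piMeasure μ₀) = ∫ U, Φ U ∂piMeasure μ₀ from rfl, h1,
    integral_prod _ hint]
  -- the inner integral is `F U · ∫ w dμ₀`
  have h3 : ∀ U : ι → G, ∫ Y, Φ (splice {c} (U, Y)) ∂piMeasure μ₀ = F U * ∫ g, w g ∂μ₀ := by
    intro U
    simp_rw [h2 U]
    rw [integral_const_mul]
    congr 1
    have hm : Measurable fun g : G => w (a U * g * b U) :=
      hw.comp ((measurable_const.mul measurable_id).mul measurable_const)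
    rw [integral_eval_eq μ₀ c hm, integral_mul_mul_eq μ₀ w (a U) (b U)]
  simp_rw [h3]
  rw [integral_mul_const, mul_comm]

/-! ## §2 The triangular identity -/

omit [Fintype ι] [DecidableEq ι] [MeasurableSpace G] [MeasurableMul₂ G] in
/-- A product of words whose letters avoid the coordinate `c` does not depend on `c`. [folklore] -/
theorem dependsOn_prod_words {s : Finset ι} {c : ι} (hcs : c ∉ s) {a b : ι → (ι → G) → G}
    (haD : ∀ i ∈ s, DependsOn (a i) {j : ι | j ≠ c}) (hbD : ∀ i ∈ s, DependsOn (b i) {j : ι | j ≠ c}) (w : ι → G → ℝ) :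
    DependsOn (fun U : ι → G => ∏ i ∈ s, w i (a i U * U i * b i U)) {j : ι | j ≠ c} := by
  intro U V hUV
  refine prod_congr rfl fun i hi => ?_
  have hic : i ≠ c := fun h => hcs (h ▸ hi)
  rw [haD i hi hUV, hbD i hi hUV, hUV i hic]

omit [Fintype ι] [DecidableEq ι] in
/-- A product of words is measurable. [folklore] -/
theorem measurable_prod_words (s : Finset ι) {a b : ι → (ι → G) → G} (ha : ∀ i, Measurable (a i))
    (hb : ∀ i, Measurable (b i)) {w : ι → G → ℝ} (hw : ∀ i, Measurable (w i)) :
    Measurable fun U : ι → G => ∏ i ∈ s, w i (a i U * U i * b i U) :=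
  Finset.measurable_prod _ fun i _ => (hw i).comp (((ha i).mul (measurable_pi_apply i)).mul (hb i))

omit [Fintype ι] [DecidableEq ι] [MeasurableSpace G] [MeasurableMul₂ G] in
/-- A product of weights in `[0, B]` lies in `[0, B^{#s}]`. [folklore] -/
theorem prod_words_mem (s : Finset ι) (a b : ι → (ι → G) → G) {w : ι → G → ℝ} (hw0 : ∀ i g, 0 ≤ w i g) {B : ℝ}
    (hwB : ∀ i g, w i g ≤ B) (U : ι → G) :
    0 ≤ ∏ i ∈ s, w i (a i U * U i * b i U) ∧ ∏ i ∈ s, w i (a i U * U i * b i U) ≤ B ^ s.card := by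
  refine ⟨prod_nonneg fun i _ => hw0 i _, ?_⟩
  rw [← prod_const]
  exact prod_le_prod (fun i _ => hw0 i _) fun i _ => hwB i _

/-- **THE TRIANGULAR IDENTITY.**  On the product `ι → G` of a bi-invariant probability measure `μ₀`: for a finite set `A` of
eliminated coordinates with ranks `r`, words `V_i(U) = a_i(U)·U(i)·b_i(U)` (`i ∈ A`) whose outer letters depend only on
coordinates `j ≠ i` that are either outside `A` or of HIGHER rank, and bounded measurable weights `w_i ≥ 0`,
`∫ ∏_{i∈A} w_i(V_i U) dμ = ∏_{i∈A} ∫ w_i dμ₀` — the words are independent and Haar-distributed (peel the coordinate of least rank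
with `integral_word_mul_eq`, induct). [folklore] -/
theorem integral_prod_words_eq (r : ι → ℕ) (A : Finset ι) {a b : ι → (ι → G) → G} (ha : ∀ i, Measurable (a i))
    (hb : ∀ i, Measurable (b i))
    (hdep : ∀ i ∈ A, DependsOn (a i) {j : ι | j ≠ i ∧ (j ∈ A → r i < r j)} ∧
      DependsOn (b i) {j : ι | j ≠ i ∧ (j ∈ A → r i < r j)})
    {w : ι → G → ℝ} (hw : ∀ i, Measurable (w i)) (hw0 : ∀ i g, 0 ≤ w i g) {B : ℝ} (hwB : ∀ i g, w i g ≤ B) :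
    ∫ U, ∏ i ∈ A, w i (a i U * U i * b i U) ∂piMeasure μ₀ = ∏ i ∈ A, ∫ g, w i g ∂μ₀ := by
  revert hdep
  refine Finset.induction_on_min_value r A ?_ ?_
  · intro _
    simp
  · intro c s hcs hmin IH hdep
    rw [prod_insert hcs]
    simp_rw [prod_insert hcs]
    -- the letters of `c` and the tail product do not depend on `c`
    have hsub : ∀ i ∈ insert c s, {j : ι | j ≠ i ∧ (j ∈ insert c s → r i < r j)} ⊆ {j : ι | j ≠ c} := by
      intro i hi j hj hjc
      rcases hj with ⟨hji, hj⟩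
      subst hjc
      rcases mem_insert.1 hi with rfl | hi'
      · exact hji rfl
      · exact absurd (hj (mem_insert_self _ _)) (not_lt.2 (hmin i hi'))
    have hac : DependsOn (a c) {j : ι | j ≠ c} := (hdep c (mem_insert_self c s)).1.mono (hsub c (mem_insert_self c s))
    have hbc : DependsOn (b c) {j : ι | j ≠ c} := (hdep c (mem_insert_self c s)).2.mono (hsub c (mem_insert_self c s))
    have has : ∀ i ∈ s, DependsOn (a i) {j : ι | j ≠ c} := fun i hi =>
      (hdep i (mem_insert_of_mem hi)).1.mono (hsub i (mem_insert_of_mem hi))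
    have hbs : ∀ i ∈ s, DependsOn (b i) {j : ι | j ≠ c} := fun i hi =>
      (hdep i (mem_insert_of_mem hi)).2.mono (hsub i (mem_insert_of_mem hi))
    have hB0 : 0 ≤ B := (hw0 c 1).trans (hwB c 1)
    have step := integral_word_mul_eq μ₀ c (ha c) (hb c) hac hbc (hw c)
      (B := B) (fun g => by rw [abs_of_nonneg (hw0 c g)]; exact hwB c g)
      (measurable_prod_words s ha hb hw) (C := B ^ s.card)
      (fun U => by
        rw [abs_of_nonneg (prod_words_mem s a b hw0 hwB U).1]
        exact (prod_words_mem s a b hw0 hwB U).2)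
      (dependsOn_prod_words hcs has hbs w)
    rw [step]
    congr 1
    refine IH fun i hi => ?_
    have hmono : {j : ι | j ≠ i ∧ (j ∈ insert c s → r i < r j)} ⊆ {j : ι | j ≠ i ∧ (j ∈ s → r i < r j)} :=
      fun j hj => ⟨hj.1, fun hjs => hj.2 (mem_insert_of_mem hjs)⟩
    exact ⟨(hdep i (mem_insert_of_mem hi)).1.mono hmono, (hdep i (mem_insert_of_mem hi)).2.mono hmono⟩

/-- **THE TRIANGULAR BOUND WITH DROPPED FACTORS.**  Same setting; an extra measurable factor `0 ≤ R ≤ 1` (the plaquettes without a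
private link, each bounded by one) only lowers the integral: `∫ (∏_{i∈A} w_i(V_i U))·R(U) dμ ≤ ∏_{i∈A} ∫ w_i dμ₀`. [folklore] -/
theorem integral_prod_words_mul_le (r : ι → ℕ) (A : Finset ι) {a b : ι → (ι → G) → G} (ha : ∀ i, Measurable (a i))
    (hb : ∀ i, Measurable (b i))
    (hdep : ∀ i ∈ A, DependsOn (a i) {j : ι | j ≠ i ∧ (j ∈ A → r i < r j)} ∧
      DependsOn (b i) {j : ι | j ≠ i ∧ (j ∈ A → r i < r j)})
    {w : ι → G → ℝ} (hw : ∀ i, Measurable (w i)) (hw0 : ∀ i g, 0 ≤ w i g) {B : ℝ} (hwB : ∀ i g, w i g ≤ B)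
    {R : (ι → G) → ℝ} (hR0 : ∀ U, 0 ≤ R U) (hR1 : ∀ U, R U ≤ 1) :
    ∫ U, (∏ i ∈ A, w i (a i U * U i * b i U)) * R U ∂piMeasure μ₀ ≤ ∏ i ∈ A, ∫ g, w i g ∂μ₀ := by
  rw [← integral_prod_words_eq μ₀ r A ha hb hdep hw hw0 hwB]
  have hPm := measurable_prod_words A ha hb hw (G := G)
  have hPint : Integrable (fun U : ι → G => ∏ i ∈ A, w i (a i U * U i * b i U)) (piMeasure μ₀) :=
    Integrable.of_bound hPm.aestronglyMeasurable (B ^ A.card) (ae_of_all _ fun U => by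
      rw [Real.norm_eq_abs, abs_of_nonneg (prod_words_mem A a b hw0 hwB U).1]
      exact (prod_words_mem A a b hw0 hwB U).2)
  refine integral_mono_of_nonneg (ae_of_all _ fun U => mul_nonneg (prod_words_mem A a b hw0 hwB U).1 (hR0 U)) hPint
    (ae_of_all _ fun U => ?_)
  exact mul_le_of_le_one_right (prod_words_mem A a b hw0 hwB U).1 (hR1 U)

/-- **THE TRIANGULAR BOUND, POWER FORM.**  If moreover every one-letter integral is `≤ z` on `A`, then
`∫ (∏_{i∈A} w_i(V_i U))·R(U) dμ ≤ z^{#A}` — the shape `Z ≤ z(β)^{#private plaquettes}` of the Gaussian upper bound on the Wilson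
partition function. [folklore] -/
theorem integral_prod_words_mul_le_pow (r : ι → ℕ) (A : Finset ι) {a b : ι → (ι → G) → G} (ha : ∀ i, Measurable (a i))
    (hb : ∀ i, Measurable (b i))
    (hdep : ∀ i ∈ A, DependsOn (a i) {j : ι | j ≠ i ∧ (j ∈ A → r i < r j)} ∧
      DependsOn (b i) {j : ι | j ≠ i ∧ (j ∈ A → r i < r j)})
    {w : ι → G → ℝ} (hw : ∀ i, Measurable (w i)) (hw0 : ∀ i g, 0 ≤ w i g) {B : ℝ} (hwB : ∀ i g, w i g ≤ B)
    {R : (ι → G) → ℝ} (hR0 : ∀ U, 0 ≤ R U) (hR1 : ∀ U, R U ≤ 1) {z : ℝ} (hz : ∀ i ∈ A, ∫ g, w i g ∂μ₀ ≤ z) :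
    ∫ U, (∏ i ∈ A, w i (a i U * U i * b i U)) * R U ∂piMeasure μ₀ ≤ z ^ A.card := by
  refine (integral_prod_words_mul_le μ₀ r A ha hb hdep hw hw0 hwB hR0 hR1).trans ?_
  rw [← prod_const]
  exact prod_le_prod (fun i _ => integral_nonneg fun g => hw0 i g) fun i hi => hz i hi

end

end Summit.QuantumFields.YangMills.Theorems.LocalInsertion.TriangularHaar
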